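import Summits.PneNP.PneNP.Theorems.ConvexRankGatesLinAlgGateBlindPlanting
import Summits.PneNP.PneNP.Theorems.ConvexRankGatesLinAlgGateBlindDenseRegime
import Summits.PneNP.PneNP.Theorems.ConvexRankGatesLinAlgGateBlindPermSmallDimAux

/-!
# Route ConvexRankGates, crux `LinAlgGateBlind` (stmt-PneNP-10681): SG_PERM up to dimension `m^{11/16-o(1)}` by the chain cover

Support lemma for the research stub `stub_sgPerm` (line `dnf-invariant-wide-gates-see-small-cliques`; vocabulary of
`Theorems/ConvexRankGatesLinAlgGateBlindDefs.lean`). The planting theorem `sg_of_maxtermCover`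
(`Theorems/ConvexRankGatesLinAlgGateBlindPlanting.lean`) gives the single-gate statement `SGAt` for every term gate
whose rejection region is covered by `N ≤ 2^{m^{3/4}/2}` all-off events of atom families. For a `PERM_d` term gate
`O(x) = [τ ∈ ⟨σ_a : ⌈X_a⌉(x)⟩]` the landed cover (`sgAt_perm_of_cover_budget`, `…PermSmallDim`) is indexed by ALL
subgroups avoiding `τ`, `N ≤ #Sub(Sym d) = 2^{O(d² log² d)}`, whence the range `d ≤ m^{3/8-o(1)}`.

THE CHAIN COVER. The rejecting subgroup `H = ⟨σ_a : a live⟩` of a rejected graph is generated by the permutations of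
at most `log₂ |Sym d'| = log₂ (d'!)` live ATOMS: adding the live atoms one at a time, the generated subgroup either
stays put or at least doubles (Lagrange), so a sub-family of `≤ log₂(d'!)` live atoms generates the same `H`
(`exists_subset_closure_eq`). Hence the rejection region is covered by the all-off events
`{every atom X_a with σ_a ∉ K off}` for the subgroups `K ∌ τ` GENERATED BY AT MOST `L = ⌊log₂ d!⌋` ATOMS, and there are
at most `#𝒱(l)^L` of those (index them by `L`-tuples of atoms, padding with the always-present atom `∅`):

* `sgAt_perm_of_chain_budget` — finite form: the positive budget `(ν·C(l,2))^t·C(m-t,k-t) ≤ ε·C(m,k)` and the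
  fragility budget `#𝒱(l)^{⌊log₂ d!⌋} · (1/2)^{ν+1} · #𝒱(l) < ε` give `SGAt m (IsPermGate d) l k q ε`;
* `sgAt_perm_of_log_mul_le` — at the parameters of the line: for every `c`, eventually in `m`, for every `d` with
  `⌊log₂ d!⌋ · log₂ #𝒱(lOf m) ≤ m^{3/4}/2`, `SGAt m (IsPermGate d) (lOf m) (kOf m) (qOf m) (epsOf c m)`;
* `sgAt_perm_of_dim_mul_log_le` — the explicit range `d · log₂ d · (lOf m · log₂ (m+1)) ≤ m^{3/4}/2`
  (`#𝒱(l) ≤ (m+1)^l`, `d! ≤ d^d`); since `lOf m ≤ m^{1/16} + 1` this is every `d ≤ m^{11/16-o(1)}`, nonabelian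
  gates included (the landed ranges were `m^{3/8-o(1)}` for all `PERM_d`, `m^{3/4-o(1)}` for commutative ones).

No new definitions. [folklore]
-/

-- `Summit.PneNP.PneNP.…` duplicates `PneNP` BY DESIGN (single-problem summit).
set_option linter.dupNamespace false

namespace Summit.PneNP.PneNP.Theorems

open Finset Filter Literature.Computability.Complexity Razborov
open Summit.PneNP.PneNP.Cruxes.LinAlgGateBlind.DnfInvariantWideGatesSeeSmallCliques

/-! ### Subgroups of a finite group are generated by few of any given generators -/

/-- **Few generators suffice (Lagrange doubling).** In a finite group, from any finite family of generators
`s i, i ∈ I` one can select a sub-family `J ⊆ I` generating the same subgroup with `2^{#J} ≤ |⟨s '' J⟩|`: add the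
generators one at a time and keep only those that enlarge the subgroup generated so far — each kept generator at
least doubles its order. [folklore] -/
theorem exists_subset_closure_eq {G ι : Type*} [Group G] [Finite G] [DecidableEq ι] (s : ι → G)
    (I : Finset ι) :
    ∃ J ⊆ I, 2 ^ #J ≤ Nat.card (Subgroup.closure (s '' (J : Set ι))) ∧
      Subgroup.closure (s '' (J : Set ι)) = Subgroup.closure (s '' (I : Set ι)) := by
  classical
  induction I using Finset.induction_on with
  | empty => exact ⟨∅, subset_rfl, by simp, rfl⟩
  | insert i I hi ih =>
    obtain ⟨J, hJI, hcard, hJ⟩ := ih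
    have hins : ∀ T : Finset ι, Subgroup.closure (s '' ((insert i T : Finset ι) : Set ι)) =
        Subgroup.closure {s i} ⊔ Subgroup.closure (s '' (T : Set ι)) := by
      intro T
      rw [coe_insert, Set.image_insert_eq, Set.insert_eq, Subgroup.closure_union]
    by_cases hmem : s i ∈ Subgroup.closure (s '' (J : Set ι))
    · refine ⟨J, hJI.trans (subset_insert i I), hcard, ?_⟩
      rw [hins I, ← hJ, eq_comm, sup_eq_right]
      exact (Subgroup.closure_le _).2 (Set.singleton_subset_iff.2 hmem)
    · have hiJ : i ∉ J := fun h => hi (hJI h)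
      refine ⟨insert i J, insert_subset_insert i hJI, ?_, by rw [hins J, hins I, hJ]⟩
      rw [card_insert_of_notMem hiJ, hins J]
      set H := Subgroup.closure (s '' (J : Set ι)) with hH
      set H' := Subgroup.closure {s i} ⊔ Subgroup.closure (s '' (J : Set ι)) with hH'
      have hle : H ≤ H' := le_sup_right
      have hne : H ≠ H' := by
        intro h
        apply hmem
        rw [h]
        exact Subgroup.mem_sup_left (Subgroup.subset_closure (Set.mem_singleton (s i)))
      have hlt : Nat.card H < Nat.card H' := by
        by_contra hge
        exact hne (Subgroup.eq_of_le_of_card_ge hle (not_lt.1 hge))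
      obtain ⟨c, hc⟩ := Subgroup.card_dvd_of_le hle
      have hHpos : 0 < Nat.card H := Nat.card_pos
      have hc2 : 2 ≤ c := by
        rcases Nat.lt_or_ge c 2 with h | h
        · interval_cases c
          · rw [hc, mul_zero] at hlt; exact absurd hlt (Nat.not_lt_zero _)
          · rw [hc, mul_one] at hlt; exact absurd hlt (lt_irrefl _)
        · exact h
      calc 2 ^ (#J + 1) = 2 ^ #J * 2 := pow_succ 2 #J
        _ ≤ Nat.card H * c := Nat.mul_le_mul hcard hc2
        _ = Nat.card H' := hc.symm

/-- **Few generators suffice**, cardinal form: a sub-family `J ⊆ I` with `#J ≤ ⌊log₂ |G|⌋` generates the same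
subgroup as `I`. [folklore] -/
theorem exists_subset_card_le_log_closure_eq {G ι : Type*} [Group G] [Finite G] [DecidableEq ι] (s : ι → G)
    (I : Finset ι) :
    ∃ J ⊆ I, #J ≤ Nat.log 2 (Nat.card G) ∧
      Subgroup.closure (s '' (J : Set ι)) = Subgroup.closure (s '' (I : Set ι)) := by
  obtain ⟨J, hJI, hcard, hJ⟩ := exists_subset_closure_eq s I
  exact ⟨J, hJI, Nat.le_log_of_pow_le one_lt_two (hcard.trans (Subgroup.card_le_card_group _)), hJ⟩

/-! ### SG_PERM from the chain cover -/

/-- **SG_PERM from the chain-cover budget (finite form).** Let `q ∈ [0,1]`, `1 - q^{C(l,2)} ≤ 1/2`, `0 < ε`,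
`2t ≤ l`, and suppose the POSITIVE budget `(ν·C(l,2))^t · C(m-t, k-t) ≤ ε·C(m,k)` and the FRAGILITY budget
`#𝒱(l)^{⌊log₂ d!⌋} · (1/2)^{ν+1} · #𝒱(l) < ε`. Then `SGAt m (IsPermGate d) l k q ε`. Proof: a `PERM_d` term gate
has permutation data `σ, τ` on `d' ≤ d` points over atoms `X_a ∈ 𝒱(l)`; for an `L`-tuple of atoms
`f : Fin L → 𝒱(l)`, `L = ⌊log₂ d'!⌋`, put `K_f = ⟨σ_a : X_a ∈ range f⟩`. A graph `x` is rejected iff for some `f`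
with `τ ∉ K_f` every atom `X_a` with `σ_a ∉ K_f` is absent from `x`: (⇐) the live generators lie in `K_f ∌ τ`;
(⇒) the live closure `H ∌ τ` is generated by the permutations of `≤ L` live atoms
(`exists_subset_card_le_log_closure_eq`, `|Sym d'| = d'!`), list them as `f` padded with the always-live atom `∅`,
then `K_f = H`. So the rejection region is covered by `N ≤ #𝒱(l)^L ≤ #𝒱(l)^{⌊log₂ d!⌋}` all-off events inside it,
and the planting theorem `sg_of_maxtermCover` with `η = ε/#𝒱(l)` concludes. [folklore] -/
theorem sgAt_perm_of_chain_budget : ∀ (m l k d ν t : ℕ) (q ε : ℝ), 0 ≤ q → q ≤ 1 →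
    1 - q ^ (l.choose 2) ≤ 1 / 2 → 0 < ε → 2 * t ≤ l →
    (((ν * l.choose 2) ^ t * (m - t).choose (k - t) : ℕ) : ℝ) ≤ ε * (m.choose k : ℝ) →
    (#(smallSets (Fin m) l) : ℝ) ^ (Nat.log 2 d.factorial) * (1 / 2) ^ (ν + 1) * #(smallSets (Fin m) l) < ε →
    SGAt m (IsPermGate d) l k q ε := by
  intro m l k d ν t q ε hq0 hq1 hql hε htl hpos hfrag O hO
  classical
  obtain ⟨g, ⟨d', hd', σ, τ, hg⟩, X, hX, hOX⟩ := hO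
  set V := smallSets (Fin m) l with hVdef
  have hV : (0 : ℝ) < #V := Nat.cast_pos.2 (card_pos.2 ⟨∅, empty_mem_smallSets l⟩)
  set L := Nat.log 2 (Nat.card (Equiv.Perm (Fin d'))) with hLdef
  have hLle : L ≤ Nat.log 2 d.factorial := by
    have hcd : Nat.card (Equiv.Perm (Fin d')) = d'.factorial := by
      rw [Nat.card_perm, Nat.card_eq_fintype_card, Fintype.card_fin]
    rw [hLdef, hcd]
    exact Nat.log_mono_right (Nat.factorial_le hd')
  -- the subgroup generated by the permutations of the atoms listed by `f`
  set K : (Fin L → V) → Subgroup (Equiv.Perm (Fin d')) :=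
    fun f => Subgroup.closure (σ '' {a | ∃ i, ((f i : V) : Finset (Fin m)) = X a}) with hKdef
  -- liveness of an input depends only on its atom
  set live : (KEdge m → Bool) → Fin g.1 → Prop := fun x a => CliquePresent (X a) x with hlive
  have hclosure_eq : ∀ x, Subgroup.closure (σ '' {i | (fun a => atomB (X a) x) i = true}) =
      Subgroup.closure (σ '' {a | live x a}) := by
    intro x
    have : {i | (fun a => atomB (X a) x) i = true} = {a | live x a} := by
      ext a
      simp [atomB, hlive]
    rw [this]
  -- the chain cover: `O x = 0` iff some `K_f ∌ τ` contains every live generator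
  have hiff : ∀ x, O x = false ↔ ∃ f : Fin L → V, τ ∉ K f ∧ ∀ a, σ a ∉ K f → ¬ live x a := by
    intro x
    rw [hOX x]
    constructor
    · intro h0
      have hτ : τ ∉ Subgroup.closure (σ '' {a | live x a}) := fun hτ => by
        rw [← hclosure_eq x] at hτ
        rw [(hg _).2 hτ] at h0
        exact Bool.noConfusion h0
      -- few live atoms generate the live closure
      obtain ⟨J, hJI, hJcard, hJ⟩ :=
        exists_subset_card_le_log_closure_eq σ (univ.filter fun a => live x a)
      have hIset : ((univ.filter fun a => live x a : Finset (Fin g.1)) : Set (Fin g.1)) = {a | live x a} := by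
        ext a
        simp
      rw [hIset] at hJ
      -- the atoms of `J`, listed as an `L`-tuple padded with `∅`
      set 𝒥 : Finset (Finset (Fin m)) := J.image X with h𝒥def
      have h𝒥V : 𝒥 ⊆ V := by
        intro Y hY
        obtain ⟨a, -, rfl⟩ := mem_image.1 hY
        exact hX a
      have h𝒥card : #𝒥 ≤ L := card_image_le.trans hJcard
      set e𝒥 := 𝒥.equivFin with he𝒥
      set f : Fin L → V := fun i =>
        if h : (i : ℕ) < #𝒥 then ⟨(e𝒥.symm ⟨i, h⟩ : Finset (Fin m)), h𝒥V (e𝒥.symm ⟨i, h⟩).2⟩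
        else ⟨∅, empty_mem_smallSets l⟩ with hfdef
      -- every listed atom is live (it is an atom of `J ⊆ live`, or `∅`)
      have hf_live : ∀ a, (∃ i, ((f i : V) : Finset (Fin m)) = X a) → live x a := by
        rintro a ⟨i, hi⟩
        by_cases h : (i : ℕ) < #𝒥
        · have hmem : X a ∈ 𝒥 := by
            rw [← hi, hfdef]
            simp only [h, dif_pos]
            exact (e𝒥.symm ⟨i, h⟩).2
          obtain ⟨b, hb, hba⟩ := mem_image.1 hmem
          have hb_live : live x b := (mem_filter.1 (hJI hb)).2
          show CliquePresent (X a) x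
          rw [← hba]
          exact hb_live
        · have hempty : X a = ∅ := by
            rw [← hi, hfdef]
            simp only [h, dif_neg, not_false_eq_true]
          show CliquePresent (X a) x
          rw [hempty]
          exact cliquePresent_empty x
      -- every generator of `J` is listed
      have hJ_listed : ∀ b ∈ J, ∃ i, ((f i : V) : Finset (Fin m)) = X b := by
        intro b hb
        have hXb : X b ∈ 𝒥 := mem_image_of_mem X hb
        refine ⟨⟨e𝒥 ⟨X b, hXb⟩, lt_of_lt_of_le (e𝒥 ⟨X b, hXb⟩).2 h𝒥card⟩, ?_⟩
        rw [hfdef]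
        simp only [(e𝒥 ⟨X b, hXb⟩).2, dif_pos, Fin.eta, Equiv.symm_apply_apply]
      have hKf : K f = Subgroup.closure (σ '' {a | live x a}) := by
        apply le_antisymm
        · refine (Subgroup.closure_le _).2 ?_
          rintro _ ⟨a, ha, rfl⟩
          exact Subgroup.subset_closure ⟨a, hf_live a ha, rfl⟩
        · rw [← hJ]
          exact Subgroup.closure_mono (Set.image_mono fun b hb => hJ_listed b hb)
      refine ⟨f, by rwa [hKf], fun a ha hla => ha ?_⟩
      rw [hKf]
      exact Subgroup.subset_closure ⟨a, hla, rfl⟩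
    · rintro ⟨f, hτ, hf⟩
      rcases hv : g.2 (fun a => atomB (X a) x) with _ | _
      · rfl
      · exfalso
        have hmem := (hg _).1 hv
        rw [hclosure_eq x] at hmem
        refine hτ ((Subgroup.closure_le (K f)).2 ?_ hmem)
        rintro _ ⟨a, ha, rfl⟩
        by_contra hK
        exact hf a hK ha
  -- index the chain cover
  set J := {f : Fin L → V // τ ∉ K f} with hJ
  set N := Nat.card J with hNdef
  set e : J ≃ Fin N := Finite.equivFin J with he
  set 𝓛 : Fin N → Finset (Finset (Fin m)) :=
    fun j => (univ.filter fun a => σ a ∉ K (e.symm j).1).image X with h𝓛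
  have hNle : (N : ℝ) ≤ (#V : ℝ) ^ (Nat.log 2 d.factorial) := by
    have h1 : N ≤ Nat.card (Fin L → V) :=
      Nat.card_le_card_of_injective (Subtype.val : J → (Fin L → V)) Subtype.val_injective
    have h2 : Nat.card (Fin L → V) = #V ^ L := by
      rw [Nat.card_eq_fintype_card, Fintype.card_fun, Fintype.card_fin, Fintype.card_coe]
    rw [h2] at h1
    have h3 : #V ^ L ≤ #V ^ Nat.log 2 d.factorial :=
      Nat.pow_le_pow_right (card_pos.2 ⟨∅, empty_mem_smallSets l⟩) hLle
    exact_mod_cast h1.trans h3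
  have hN : (N : ℝ) * (1 / 2) ^ (ν + 1) < ε / #V := by
    rw [lt_div_iff₀ hV]
    calc (N : ℝ) * (1 / 2) ^ (ν + 1) * #V
        ≤ (#V : ℝ) ^ (Nat.log 2 d.factorial) * (1 / 2) ^ (ν + 1) * #V := by gcongr
      _ < ε := hfrag
  have h1 : ∀ j, 𝓛 j ⊆ V := by
    intro j Y hY
    obtain ⟨a, -, rfl⟩ := mem_image.1 hY
    exact hX a
  have h2 : ∀ x, O x = false → ∃ j, ∀ Y ∈ 𝓛 j, ¬ CliquePresent Y x := by
    intro x hx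
    obtain ⟨f, hτ, hf⟩ := (hiff x).1 hx
    refine ⟨e ⟨f, hτ⟩, fun Y hY => ?_⟩
    obtain ⟨a, ha, rfl⟩ := mem_image.1 hY
    rw [mem_filter, Equiv.symm_apply_apply] at ha
    exact hf a ha.2
  have h3 : ∀ j x, (∀ Y ∈ 𝓛 j, ¬ CliquePresent Y x) → O x = false := fun j x hall =>
    (hiff x).2 ⟨(e.symm j).1, (e.symm j).2, fun a ha =>
      hall (X a) (mem_image_of_mem X (mem_filter.2 ⟨mem_univ a, ha⟩))⟩
  obtain ⟨𝒜, h𝒜, hP, hNg⟩ := sg_of_maxtermCover m l k N ν t q (ε / #V) O 𝓛 h1 h2 h3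
    hq0 hq1 hql (div_pos hε hV) hN htl
  refine ⟨𝒜, h𝒜, ?_, hNg.trans_eq (mul_div_cancel₀ ε hV.ne')⟩
  calc (#(lostPos m k O 𝒜) : ℝ) ≤ (((ν * l.choose 2) ^ t * (m - t).choose (k - t) : ℕ) : ℝ) := by
        exact_mod_cast hP
    _ ≤ ε * (m.choose k : ℝ) := hpos

/-! ### At the parameters of the line -/

open DenseRegime in
/-- **SG_PERM whenever `⌊log₂ d!⌋ · log₂ #𝒱(lOf m) ≤ m^{3/4}/2`** (corollary of the chain cover at the line's
parameters). For every `c`, eventually in `m`, for every such `d`: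
`SGAt m (IsPermGate d) (lOf m) (kOf m) (qOf m) (epsOf c m)`. Proof: `sgAt_perm_of_chain_budget` with
`ν = ⌈m^{3/4}⌉₊`, `t = ⌊lOf m/2⌋`, the dense-regime facts `0 ≤ q ≤ 1`, `q^{C(l,2)} ≥ 1/2` (`stub_denseRegime`) and
the budgets `permSmallDim_budgets` (`#𝒱^{L} = 2^{L log₂ #𝒱} ≤ 2^{m^{3/4}/2}`). [folklore] -/
theorem sgAt_perm_of_log_mul_le : ∀ c : ℕ, ∀ᶠ m : ℕ in atTop, ∀ d : ℕ,
    (Nat.log 2 d.factorial : ℝ) * Real.logb 2 (#(smallSets (Fin m) (lOf m)) : ℝ) ≤ (m : ℝ) ^ (3 / 4 : ℝ) / 2 →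
    SGAt m (IsPermGate d) (lOf m) (kOf m) (qOf m) (epsOf c m) := by
  intro c
  filter_upwards [stub_denseRegime c, permSmallDim_budgets c, eventually_ge_atTop 1] with m hD hB hm d hd
  obtain ⟨-, -, -, hq0, hq1, -, -, -, -, hhalf⟩ := hD
  obtain ⟨hpos, hfrag⟩ := hB
  have hmpos : (0 : ℝ) < m := by exact_mod_cast hm
  have hε : 0 < epsOf c m := by
    rw [epsOf_eq]
    positivity
  have hV : (0 : ℝ) < #(smallSets (Fin m) (lOf m)) :=
    Nat.cast_pos.2 (card_pos.2 ⟨∅, empty_mem_smallSets (lOf m)⟩)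
  have hcard : (#(smallSets (Fin m) (lOf m)) : ℝ) ^ (Nat.log 2 d.factorial) ≤
      (2 : ℝ) ^ ((m : ℝ) ^ (3 / 4 : ℝ) / 2) := by
    have : (#(smallSets (Fin m) (lOf m)) : ℝ) ^ (Nat.log 2 d.factorial) =
        (2 : ℝ) ^ ((Nat.log 2 d.factorial : ℝ) * Real.logb 2 (#(smallSets (Fin m) (lOf m)) : ℝ)) := by
      rw [mul_comm, Real.rpow_mul (by norm_num : (0 : ℝ) ≤ 2), Real.rpow_logb two_pos (by norm_num) hV,
        Real.rpow_natCast]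
    rw [this]
    exact Real.rpow_le_rpow_of_exponent_le one_le_two hd
  refine sgAt_perm_of_chain_budget m (lOf m) (kOf m) d ⌈(m : ℝ) ^ (3 / 4 : ℝ)⌉₊ (lOf m / 2)
    (qOf m) (epsOf c m) hq0 hq1 (by linarith) hε (Nat.mul_div_le (lOf m) 2) hpos ?_
  calc (#(smallSets (Fin m) (lOf m)) : ℝ) ^ (Nat.log 2 d.factorial) * (1 / 2) ^ (⌈(m : ℝ) ^ (3 / 4 : ℝ)⌉₊ + 1) *
        #(smallSets (Fin m) (lOf m))
      ≤ (2 : ℝ) ^ ((m : ℝ) ^ (3 / 4 : ℝ) / 2) * (1 / 2) ^ (⌈(m : ℝ) ^ (3 / 4 : ℝ)⌉₊ + 1) *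
        #(smallSets (Fin m) (lOf m)) := by gcongr
    _ < epsOf c m := hfrag

/-- `⌊log₂ d!⌋ ≤ d · log₂ d` (`d! ≤ d^d`). [folklore] -/
theorem natLog_factorial_le (d : ℕ) : (Nat.log 2 d.factorial : ℝ) ≤ d * Real.logb 2 d := by
  have hfact : (0 : ℝ) < (d.factorial : ℝ) := by exact_mod_cast Nat.factorial_pos d
  have h1 : (Nat.log 2 d.factorial : ℝ) ≤ Real.logb 2 (d.factorial : ℝ) := by
    have := Real.natLog_le_logb d.factorial 2
    push_cast at this
    exact this
  refine h1.trans ?_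
  rcases Nat.eq_zero_or_pos d with rfl | hd
  · simp
  · calc Real.logb 2 (d.factorial : ℝ) ≤ Real.logb 2 ((d : ℝ) ^ d) :=
          Real.logb_le_logb_of_le one_lt_two hfact (by exact_mod_cast Nat.factorial_le_pow d)
      _ = d * Real.logb 2 d := Real.logb_pow _ _ _

/-- `log₂ #𝒱(l) ≤ l · log₂ (m + 1)` on `m` vertices (`#𝒱(l) ≤ (m+1)^l`, `Razborov.card_smallSets_le`). [folklore] -/
theorem logb_card_smallSets_le (m l : ℕ) :
    Real.logb 2 (#(smallSets (Fin m) l) : ℝ) ≤ l * Real.logb 2 ((m : ℝ) + 1) := by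
  have hV : (0 : ℝ) < #(smallSets (Fin m) l) := Nat.cast_pos.2 (card_pos.2 ⟨∅, empty_mem_smallSets l⟩)
  have h := card_smallSets_le (α := Fin m) l
  rw [Fintype.card_fin] at h
  calc Real.logb 2 (#(smallSets (Fin m) l) : ℝ) ≤ Real.logb 2 (((m : ℝ) + 1) ^ l) :=
        Real.logb_le_logb_of_le one_lt_two hV (by exact_mod_cast h)
    _ = l * Real.logb 2 ((m : ℝ) + 1) := Real.logb_pow _ _ _

/-- **SG_PERM for all `PERM_d` gates with `d · log₂ d · (lOf m · log₂ (m+1)) ≤ m^{3/4}/2`** — every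
`d ≤ m^{11/16-o(1)}`, nonabelian gates included — at every level `c`, eventually in `m`:
`sgAt_perm_of_log_mul_le` with `⌊log₂ d!⌋ ≤ d log₂ d` and `log₂ #𝒱(l) ≤ l log₂(m+1)`. [folklore] -/
theorem sgAt_perm_of_dim_mul_log_le : ∀ c : ℕ, ∀ᶠ m : ℕ in atTop, ∀ d : ℕ,
    (d : ℝ) * Real.logb 2 d * ((lOf m : ℝ) * Real.logb 2 ((m : ℝ) + 1)) ≤ (m : ℝ) ^ (3 / 4 : ℝ) / 2 →
    SGAt m (IsPermGate d) (lOf m) (kOf m) (qOf m) (epsOf c m) := by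
  intro c
  filter_upwards [sgAt_perm_of_log_mul_le c] with m hm d hd
  refine hm d (le_trans ?_ hd)
  have h0 : (0 : ℝ) ≤ Nat.log 2 d.factorial := Nat.cast_nonneg _
  have hV1 : (1 : ℝ) ≤ #(smallSets (Fin m) (lOf m)) := by
    exact_mod_cast card_pos.2 ⟨∅, empty_mem_smallSets (lOf m)⟩
  have hlog0 : 0 ≤ Real.logb 2 (#(smallSets (Fin m) (lOf m)) : ℝ) := Real.logb_nonneg one_lt_two hV1
  exact mul_le_mul (natLog_factorial_le d) (logb_card_smallSets_le m (lOf m)) hlog0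
    (mul_nonneg (Nat.cast_nonneg d) (DenseRegime.logb_two_nonneg d))

open DenseRegime in
/-- **SG_PERM for all `PERM_d` gates with `d · log₂ d ≤ m^{11/16} / (8 log₂ m)`** at every level `c`, eventually in
`m` (the range `d ≤ m^{11/16-o(1)}` in closed form): `sgAt_perm_of_dim_mul_log_le` with `lOf m ≤ m^{1/16} + 1 ≤ 2m^{1/16}`
and `log₂(m+1) ≤ log₂ m + 1 ≤ 2 log₂ m`, `m^{11/16} · m^{1/16} = m^{3/4}`. [folklore] -/
theorem sgAt_perm_of_dim_le_rpow : ∀ c : ℕ, ∀ᶠ m : ℕ in atTop, ∀ d : ℕ,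
    (d : ℝ) * Real.logb 2 d ≤ (m : ℝ) ^ (11 / 16 : ℝ) / (8 * Real.logb 2 m) →
    SGAt m (IsPermGate d) (lOf m) (kOf m) (qOf m) (epsOf c m) := by
  intro c
  filter_upwards [sgAt_perm_of_dim_mul_log_le c, eventually_ge_atTop 2] with m hm hm2 d hd
  refine hm d (le_trans ?_ (?_ : (m : ℝ) ^ (11 / 16 : ℝ) / (8 * Real.logb 2 m) *
    (((m : ℝ) ^ (1 / 16 : ℝ) + 1) * (Real.logb 2 m + 1)) ≤ _))
  · -- monotonicity in the two factors
    have hm1 : 1 ≤ m := le_trans (by norm_num) hm2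
    have hmR : (2 : ℝ) ≤ m := by exact_mod_cast hm2
    have hmpos : (0 : ℝ) < m := by linarith
    have hL1 : 1 ≤ Real.logb 2 m := by
      rw [← Real.logb_self_eq_one one_lt_two]
      exact Real.logb_le_logb_of_le one_lt_two two_pos hmR
    have hlOf : (lOf m : ℝ) ≤ (m : ℝ) ^ (1 / 16 : ℝ) + 1 := lOf_le_rpow_add_one m
    have hlog : Real.logb 2 ((m : ℝ) + 1) ≤ Real.logb 2 m + 1 :=
      calc Real.logb 2 ((m : ℝ) + 1) ≤ Real.logb 2 (2 * m) :=
            Real.logb_le_logb_of_le one_lt_two (by positivity) (by linarith)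
        _ = Real.logb 2 2 + Real.logb 2 m := Real.logb_mul (by norm_num) hmpos.ne'
        _ = Real.logb 2 m + 1 := by rw [Real.logb_self_eq_one one_lt_two, add_comm]
    have hlog0 : 0 ≤ Real.logb 2 ((m : ℝ) + 1) := Real.logb_nonneg one_lt_two (by linarith)
    have hfac : (lOf m : ℝ) * Real.logb 2 ((m : ℝ) + 1) ≤ ((m : ℝ) ^ (1 / 16 : ℝ) + 1) * (Real.logb 2 m + 1) :=
      mul_le_mul hlOf hlog hlog0 (by positivity)
    refine mul_le_mul hd hfac (mul_nonneg (Nat.cast_nonneg _) hlog0) ?_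
    exact div_nonneg (by positivity) (by positivity)
  · -- `(x+1)(L+1) ≤ 4xL` and `m^{11/16} · x = m^{3/4}`
    have hm1 : 1 ≤ m := le_trans (by norm_num) hm2
    have hmR : (2 : ℝ) ≤ m := by exact_mod_cast hm2
    have hmpos : (0 : ℝ) < m := by linarith
    have hx1 : (1 : ℝ) ≤ (m : ℝ) ^ (1 / 16 : ℝ) := one_le_rpow_sixteenth hm1
    have hL1 : 1 ≤ Real.logb 2 m := by
      rw [← Real.logb_self_eq_one one_lt_two]
      exact Real.logb_le_logb_of_le one_lt_two two_pos hmR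
    have hLpos : 0 < Real.logb 2 m := by linarith
    have hprod : ((m : ℝ) ^ (1 / 16 : ℝ) + 1) * (Real.logb 2 m + 1) ≤ 4 * (m : ℝ) ^ (1 / 16 : ℝ) * Real.logb 2 m := by
      nlinarith [mul_le_mul (show (m : ℝ) ^ (1 / 16 : ℝ) + 1 ≤ 2 * (m : ℝ) ^ (1 / 16 : ℝ) by linarith)
        (show Real.logb 2 m + 1 ≤ 2 * Real.logb 2 m by linarith) (by linarith) (by linarith)]
    have h34 : (m : ℝ) ^ (11 / 16 : ℝ) * (m : ℝ) ^ (1 / 16 : ℝ) = (m : ℝ) ^ (3 / 4 : ℝ) := by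
      rw [← Real.rpow_add hmpos]
      norm_num
    calc (m : ℝ) ^ (11 / 16 : ℝ) / (8 * Real.logb 2 m) * (((m : ℝ) ^ (1 / 16 : ℝ) + 1) * (Real.logb 2 m + 1))
        ≤ (m : ℝ) ^ (11 / 16 : ℝ) / (8 * Real.logb 2 m) * (4 * (m : ℝ) ^ (1 / 16 : ℝ) * Real.logb 2 m) :=
          mul_le_mul_of_nonneg_left hprod (div_nonneg (by positivity) (by positivity))
      _ = (m : ℝ) ^ (11 / 16 : ℝ) * (m : ℝ) ^ (1 / 16 : ℝ) / 2 := by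
          field_simp
          ring
      _ = (m : ℝ) ^ (3 / 4 : ℝ) / 2 := by rw [h34]

end Summit.PneNP.PneNP.Theorems
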